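import Mathlib.MeasureTheory.Integral.IntervalIntegral.Periodic
import Literature.Probability.LatticeModels.LatticeGraph
import Literature.Probability.LatticeModels.MMPInequality
import HarnessLib

/-!
# Griffiths' first inequality for the plane rotator on a finite bond system, and the torus Haar
integral in angles

Folklore complements to the pure XY (plane-rotator) model
`exp (β ∑_a cos(θ_{tgt a} − θ_{src a})) dθ` on a finite bond system (`BondSystem`, `torusHaar`,
`cosDiff` of `DisorderedXYModel.lean`):

* **The torus Haar integral in angles** (`integral_torusHaar_eq_smul_setIntegral_Ioc`,
  `integral_torusHaar_eq_smul_setIntegral_Icc`): for the Haar probability measure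
  `torusHaar V = ∏_v dθ_v` of `U(1)^V` and every base point `t`,
  `∫ F dθ = (2π)^{-|V|} ∫_{(t, t+2π]^V} F((e^{iθ_v})_v) dθ`, in particular with the closed cube
  `[0, 2π]^V` (its faces are Lebesgue-null).  The one-dimensional input is that `θ ↦ e^{iθ}` pushes
  `(2π)⁻¹ dθ` on `(t, t + 2π]` to the normalised Haar measure of `U(1)` (left invariance and
  uniqueness of Haar measure; `map_exp_smul_volume_Ioc`, the base-point-free form of
  `Literature.MathematicalPhysics.QuantumFieldTheory.CircleHaar.map_exp_angleMeasure`, restated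
  here over `haarMeasure ⊤` with `[MeasurableSpace Circle] [BorelSpace Circle]` as instance
  arguments, the convention of this directory).
* **Griffiths' first inequality** (`BondSystem.expect_one_cosDiff_nonneg`): at `β ≥ 0` every
  two-point function is non-negative, `0 ≤ ⟨cos(θ_x − θ_y)⟩_β` (Ginibre 1970, plane-rotator
  example).  It is deduced from the tree's Messager–Miracle-Solé–Pfister inequality
  `BondSystem.expect_cosDiff_le_expect_one` (`⟨cos(θ_x − θ_y)⟩_u ≤ ⟨cos(θ_x − θ_y)⟩_1` for all bond
  phases `u`) at the pure gauge `u = Y(φ, 1)`, `φ_y = −1` and `φ = 1` elsewhere, whose two-point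
  function is `−⟨cos(θ_x − θ_y)⟩_1` by gauge covariance (`x ≠ y`).  The angle forms
  `0 ≤ ∫_{[0,2π]^V} cos(θ_x − θ_y) exp (β ∑_a cos(θ_{tgt a} − θ_{src a})) dθ`
  (`BondSystem.setIntegral_cos_mul_exp_nonneg`; on the discrete torus `(ℤ/Lℤ)^d` with its directed
  bonds `(z, i)`, `setIntegral_torus_cos_mul_exp_nonneg`) follow by the first item.

Theorems only; no definition and no named fact is introduced.

## References

* J. Ginibre, *General formulation of Griffiths' inequalities*, Comm. Math. Phys. 16 (1970)
  310–328, main theorem with the plane-rotator example. [Ginibre1970]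
* C. Garban, T. Spencer, J. Math. Phys. 63 (2022) 093302, Remark 1 and Appendix Thm 7.1
  (the Messager–Miracle-Solé–Pfister inequality). [GarbanSpencer2022]
-/

noncomputable section

open MeasureTheory MeasureTheory.Measure Set Filter Finset TopologicalSpace
open scoped BigOperators ComplexConjugate ENNReal

namespace Literature.Probability.LatticeModels

/-! ### The Haar probability measure of `U(1)` in the angle parametrisation -/

section Angle

variable [MeasurableSpace Circle] [BorelSpace Circle]

/-- **`θ ↦ e^{iθ}` pushes the normalised Lebesgue measure `(2π)⁻¹ dθ` on any period window
`(t, t + 2π]` to the normalised Haar measure of `U(1)`**: `e^{iθ} = toCircle (θ mod 2π)`, the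
quotient map pushes `dθ` on `(t, t + 2π]` to the Haar measure of `ℝ/2πℤ` (Mathlib's
`AddCircle.measurePreserving_mk`), and the isomorphism `toCircle : ℝ/2πℤ → U(1)` pushes the latter
to `2π` times the normalised Haar measure of `U(1)` (a left-invariant measure of mass `2π`;
uniqueness of Haar measure). [folklore] -/
theorem map_exp_smul_volume_Ioc (t : ℝ) :
    ((ENNReal.ofReal (2 * Real.pi))⁻¹ • (volume : Measure ℝ).restrict (Ioc t (t + 2 * Real.pi))).map
        Circle.exp = haarMeasure (⊤ : PositiveCompacts Circle) := by
  -- adapted from `Literature.MathematicalPhysics.QuantumFieldTheory.CircleHaar`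
  -- (`map_toCircle_volume`, `map_exp_angleMeasure`)
  haveI : Fact (0 < 2 * Real.pi) := ⟨by positivity⟩
  have h2pi : ENNReal.ofReal (2 * Real.pi) ≠ 0 := (ENNReal.ofReal_pos.2 (by positivity)).ne'
  have hcoe : ∀ θ : ℝ, AddCircle.toCircle ((θ : ℝ) : AddCircle (2 * Real.pi)) = Circle.exp θ :=
    fun θ => by rw [AddCircle.toCircle_apply_mk, div_self (by positivity), one_mul]
  have hmeas : Measurable (AddCircle.toCircle (T := 2 * Real.pi)) :=
    AddCircle.continuous_toCircle.measurable
  -- the push-forward of the Haar measure of `ℝ/2πℤ` to `U(1)` is `2π` times the normalised one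
  have hto : (volume : Measure (AddCircle (2 * Real.pi))).map AddCircle.toCircle =
      ENNReal.ofReal (2 * Real.pi) • haarMeasure (⊤ : PositiveCompacts Circle) := by
    set ν := (volume : Measure (AddCircle (2 * Real.pi))).map AddCircle.toCircle with hν
    have hsurj : Function.Surjective (AddCircle.toCircle (T := 2 * Real.pi)) := by
      intro w
      obtain ⟨θ, rfl⟩ := Circle.exp_surjective w
      exact ⟨θ, hcoe θ⟩
    haveI : ν.IsMulLeftInvariant := by
      refine ⟨fun w => ?_⟩
      obtain ⟨a, rfl⟩ := hsurj w
      rw [hν, Measure.map_map (measurable_const_mul _) hmeas]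
      have hcomp : (fun z => AddCircle.toCircle a * z) ∘ AddCircle.toCircle (T := 2 * Real.pi) =
          AddCircle.toCircle ∘ fun x => a + x := by
        funext x
        simp [AddCircle.toCircle_add]
      rw [hcomp, ← Measure.map_map hmeas (measurable_const_add a), map_add_left_eq_self]
    have huniq := haarMeasure_unique ν (⊤ : PositiveCompacts Circle)
    have htop : ν (⊤ : PositiveCompacts Circle) = ENNReal.ofReal (2 * Real.pi) := by
      rw [PositiveCompacts.coe_top, hν, Measure.map_apply hmeas MeasurableSet.univ,
        Set.preimage_univ, AddCircle.measure_univ]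
    rw [huniq, htop]
  have hfac : (Circle.exp : ℝ → Circle) =
      AddCircle.toCircle ∘ ((↑) : ℝ → AddCircle (2 * Real.pi)) := by
    funext θ; exact (hcoe θ).symm
  have hmk : Measurable (fun θ : ℝ => (θ : AddCircle (2 * Real.pi))) :=
    (AddCircle.continuous_mk' (2 * Real.pi)).measurable
  rw [Measure.map_smul, hfac, ← Measure.map_map hmeas hmk,
    (AddCircle.measurePreserving_mk (2 * Real.pi) t).map_eq, hto, smul_smul,
    ENNReal.inv_mul_cancel h2pi ENNReal.ofReal_ne_top, one_smul]

/-- `θ ↦ e^{iθ}` is measure preserving from `(2π)⁻¹ dθ` on `(t, t + 2π]` to the normalised Haar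
measure of `U(1)`. [folklore] -/
theorem measurePreserving_exp_smul_volume_Ioc (t : ℝ) :
    MeasurePreserving Circle.exp
      ((ENNReal.ofReal (2 * Real.pi))⁻¹ • (volume : Measure ℝ).restrict (Ioc t (t + 2 * Real.pi)))
      (haarMeasure (⊤ : PositiveCompacts Circle)) :=
  ⟨Circle.exp.continuous.measurable, map_exp_smul_volume_Ioc t⟩

/-! ### The Haar probability measure of the torus `U(1)^V` in angles -/

variable {V : Type*} [Fintype V]

omit [MeasurableSpace Circle] [BorelSpace Circle] in
/-- Scaling every factor scales a finite product measure by the power of the constant. [folklore] -/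
theorem pi_const_smul_measure {α : Type*} [MeasurableSpace α] (μ : Measure α) [SigmaFinite μ]
    (c : ℝ≥0∞) [SigmaFinite (c • μ)] :
    Measure.pi (fun _ : V => c • μ) = c ^ Fintype.card V • Measure.pi fun _ : V => μ := by
  -- adapted from `Literature.MathematicalPhysics.QuantumFieldTheory.CircleHaar.pi_const_smul`
  refine Measure.pi_eq fun s _ => ?_
  rw [Measure.smul_apply, Measure.pi_pi, smul_eq_mul]
  simp only [Measure.smul_apply, smul_eq_mul]
  rw [Finset.prod_mul_distrib, Finset.prod_const, Finset.card_univ]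

/-- `θ ↦ (e^{iθ_v})_v` is measure preserving from the product of the normalised angle measures on
`(t, t + 2π]` to the Haar probability measure `torusHaar V` of `U(1)^V`. [folklore] -/
theorem measurePreserving_exp_pi_torusHaar (t : ℝ) :
    MeasurePreserving (fun θ : V → ℝ => fun v => Circle.exp (θ v))
      (Measure.pi fun _ : V =>
        (ENNReal.ofReal (2 * Real.pi))⁻¹ • (volume : Measure ℝ).restrict (Ioc t (t + 2 * Real.pi)))
      (torusHaar V) :=
  measurePreserving_pi _ _ fun _ => measurePreserving_exp_smul_volume_Ioc t

omit [MeasurableSpace Circle] [BorelSpace Circle] in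
/-- The product of the normalised angle measures is `(2π)^{-|V|}` times Lebesgue measure restricted
to the cube `(t, t + 2π]^V`. [folklore] -/
theorem pi_smul_volume_Ioc (t : ℝ) :
    Measure.pi (fun _ : V => (ENNReal.ofReal (2 * Real.pi))⁻¹ •
        (volume : Measure ℝ).restrict (Ioc t (t + 2 * Real.pi))) =
      (ENNReal.ofReal (2 * Real.pi))⁻¹ ^ Fintype.card V •
        (volume : Measure (V → ℝ)).restrict (Set.pi univ fun _ => Ioc t (t + 2 * Real.pi)) := by
  haveI : IsFiniteMeasure ((ENNReal.ofReal (2 * Real.pi))⁻¹ •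
      (volume : Measure ℝ).restrict (Ioc t (t + 2 * Real.pi))) :=
    Measure.smul_finite _ (ENNReal.inv_ne_top.2 (ENNReal.ofReal_pos.2 (by positivity)).ne')
  rw [pi_const_smul_measure, ← Measure.restrict_pi_pi, volume_pi]

/-- **Haar integrals over `U(1)^V` in angles on a period window**:
`∫ F dθ = (2π)^{-|V|} ∫_{(t, t+2π]^V} F((e^{iθ_v})_v) dθ` for `F` a.e.-strongly measurable.
[folklore] -/
theorem integral_torusHaar_eq_smul_setIntegral_Ioc {E : Type*} [NormedAddCommGroup E]
    [NormedSpace ℝ E] (t : ℝ) (F : (V → Circle) → E) (hF : AEStronglyMeasurable F (torusHaar V)) :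
    ∫ u, F u ∂torusHaar V =
      ((2 * Real.pi)⁻¹) ^ Fintype.card V •
        ∫ θ in Set.pi univ (fun _ : V => Ioc t (t + 2 * Real.pi)),
          F (fun v => Circle.exp (θ v)) := by
  have h := measurePreserving_exp_pi_torusHaar (V := V) t
  rw [← h.map_eq] at hF ⊢
  rw [integral_map h.measurable.aemeasurable hF, pi_smul_volume_Ioc, integral_smul_measure,
    ENNReal.toReal_pow, ENNReal.toReal_inv, ENNReal.toReal_ofReal (by positivity)]

/-- **Haar integrals over `U(1)^V` in angles on the closed cube `[0, 2π]^V`**: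
`∫ F dθ = (2π)^{-|V|} ∫_{[0, 2π]^V} F((e^{iθ_v})_v) dθ` (the faces of the cube are null).
[folklore] -/
theorem integral_torusHaar_eq_smul_setIntegral_Icc {E : Type*} [NormedAddCommGroup E]
    [NormedSpace ℝ E] (F : (V → Circle) → E) (hF : AEStronglyMeasurable F (torusHaar V)) :
    ∫ u, F u ∂torusHaar V =
      ((2 * Real.pi)⁻¹) ^ Fintype.card V •
        ∫ θ in Set.pi univ (fun _ : V => Icc 0 (2 * Real.pi)), F (fun v => Circle.exp (θ v)) := by
  rw [integral_torusHaar_eq_smul_setIntegral_Ioc 0 F hF, zero_add]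
  congr 1
  refine setIntegral_congr_set ?_
  have h := Measure.univ_pi_Ioc_ae_eq_Icc (μ := fun _ : V => (volume : Measure ℝ))
    (f := fun _ => (0 : ℝ)) (g := fun _ => 2 * Real.pi)
  rw [← Set.pi_univ_Icc] at h
  rw [volume_pi]
  exact h

end Angle

/-! ### The XY observables in angles -/

section Observables

variable {V ι : Type*}

/-- `Re (conj e^{ia} · e^{ib}) = cos (b − a)`. [folklore] -/
theorem re_conj_coe_exp_mul_coe_exp (a b : ℝ) :
    (conj ((Circle.exp a : Circle) : ℂ) * (Circle.exp b : Circle)).re = Real.cos (b - a) := by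
  rw [Circle.coe_exp, Circle.coe_exp, Complex.mul_re, Complex.conj_re, Complex.conj_im,
    Complex.exp_ofReal_mul_I_re, Complex.exp_ofReal_mul_I_im, Complex.exp_ofReal_mul_I_re,
    Complex.exp_ofReal_mul_I_im, Real.cos_sub]
  ring

/-- The two-point observable in angles: `cosDiff x y (e^{iθ}) = cos(θ_x − θ_y)`. [folklore] -/
theorem cosDiff_exp (x y : V) (θ : V → ℝ) :
    cosDiff x y (fun v => Circle.exp (θ v)) = Real.cos (θ x - θ y) := by
  rw [cosDiff, re_conj_coe_exp_mul_coe_exp, ← Real.cos_neg, neg_sub]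

/-- Flipping the spin at `y` flips the sign of `cos(θ_x − θ_y)` (`x ≠ y`). [folklore] -/
theorem cosDiff_mul_inv_mulSingle_neg_one [DecidableEq V] {x y : V} (hxy : x ≠ y)
    (θ : V → Circle) : cosDiff x y (θ * (Pi.mulSingle y (-1 : Circle))⁻¹) = -cosDiff x y θ := by
  simp [cosDiff, hxy]

/-- The pure XY energy in angles: `∑_a cos(θ_{tgt a} − θ_{src a})`. [folklore] -/
theorem BondSystem.energy_one_exp [Fintype ι] (G : BondSystem V ι) (θ : V → ℝ) :
    G.energy 1 (fun v => Circle.exp (θ v)) = ∑ a, Real.cos (θ (G.tgt a) - θ (G.src a)) := by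
  rw [G.energy_one]
  exact Finset.sum_congr rfl fun a _ => re_conj_coe_exp_mul_coe_exp _ _

/-- The pure XY weight in angles: `exp (β ∑_a cos(θ_{tgt a} − θ_{src a}))`. [folklore] -/
theorem BondSystem.weight_one_exp [Fintype ι] (G : BondSystem V ι) (β : ℝ) (θ : V → ℝ) :
    G.weight β 1 (fun v => Circle.exp (θ v)) =
      Real.exp (β * ∑ a, Real.cos (θ (G.tgt a) - θ (G.src a))) := by
  rw [BondSystem.weight, G.energy_one_exp]

end Observables

/-! ### Griffiths' first inequality -/

namespace BondSystem

variable {V ι : Type*} [Fintype ι] (G : BondSystem V ι)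

variable [Fintype V] [MeasurableSpace Circle] [BorelSpace Circle]

/-- Gibbs expectations are odd under `f ↦ −f`. [folklore] -/
theorem expect_neg (β : ℝ) (u : ι → Circle) (f : (V → Circle) → ℝ) :
    G.expect β u (fun θ => -f θ) = -G.expect β u f := by
  simp only [expect, neg_mul, integral_neg, neg_div]

/-- Gauge covariance of real expectations: `⟨f⟩_{u · Y(φ,1)} = ⟨f(· φ⁻¹)⟩_u`. [folklore] -/
theorem expect_mul_bondVar_one (β : ℝ) (u : ι → Circle) (φ : V → Circle) (f : (V → Circle) → ℝ) :
    G.expect β (u * G.bondVar 1 φ) f = G.expect β u (fun θ => f (θ * φ⁻¹)) := by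
  have h := G.cexpect_mul_bondVar_one β u φ (fun θ => (f θ : ℂ))
  rw [cexpect_ofReal] at h
  have h' : G.cexpect β u (fun θ => ((f (θ * φ⁻¹) : ℝ) : ℂ)) =
      (G.expect β u (fun θ => f (θ * φ⁻¹)) : ℂ) := G.cexpect_ofReal β u _
  exact_mod_cast h.trans h'

/-- **Griffiths' first inequality for the plane rotator (Ginibre 1970), Haar form**: on any finite
bond system at `β ≥ 0`, `0 ≤ ⟨cos(θ_x − θ_y)⟩_β`.  Proof: by the Messager–Miracle-Solé–Pfister
inequality the pure model dominates the model with the pure-gauge phases `Y(φ, 1)`, `φ_y = −1`,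
whose two-point function is `−⟨cos(θ_x − θ_y)⟩_β` by gauge covariance.
[cite: Ginibre1970, main theorem with the plane-rotator example] -/
theorem expect_one_cosDiff_nonneg {β : ℝ} (hβ : 0 ≤ β) (x y : V) :
    0 ≤ G.expect β 1 (cosDiff x y) := by
  classical
  by_cases hxy : x = y
  · subst hxy
    have h1 : (cosDiff x x : (V → Circle) → ℝ) = fun _ => 1 := funext fun θ => cosDiff_self x θ
    rw [h1, expect_one]
    exact zero_le_one
  set φ : V → Circle := Pi.mulSingle y (-1 : Circle) with hφ
  have hmmp := G.expect_cosDiff_le_expect_one hβ (G.bondVar 1 φ) x y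
  have hg : G.expect β (G.bondVar 1 φ) (cosDiff x y) = -G.expect β 1 (cosDiff x y) := by
    have h := G.expect_mul_bondVar_one β 1 φ (cosDiff x y)
    rw [one_mul] at h
    rw [h]
    simp_rw [hφ, cosDiff_mul_inv_mulSingle_neg_one hxy]
    exact G.expect_neg β 1 _
  linarith

/-- Griffiths' first inequality, un-normalised Haar form:
`0 ≤ ∫ cos(θ_x − θ_y) exp (β ∑_a cos(θ_{tgt a} − θ_{src a})) dθ` (`β ≥ 0`).
[cite: Ginibre1970, main theorem with the plane-rotator example] -/
theorem integral_cosDiff_mul_weight_one_nonneg {β : ℝ} (hβ : 0 ≤ β) (x y : V) :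
    0 ≤ ∫ θ, cosDiff x y θ * G.weight β 1 θ ∂torusHaar V := by
  have h := mul_nonneg (G.expect_one_cosDiff_nonneg hβ x y) (G.partitionFn_pos β 1).le
  rwa [expect, div_mul_cancel₀ _ (G.partitionFn_pos β 1).ne'] at h

end BondSystem

/-- **Griffiths' first inequality for the plane rotator, angle form**: for a finite bond system,
`β ≥ 0` and sites `x, y`,
`0 ≤ ∫_{[0,2π]^V} cos(θ_x − θ_y) exp (β ∑_a cos(θ_{tgt a} − θ_{src a})) dθ`
(Lebesgue measure on the closed angle cube; the Haar form transported by
`integral_torusHaar_eq_smul_setIntegral_Icc`).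
[cite: Ginibre1970, main theorem with the plane-rotator example] -/
theorem BondSystem.setIntegral_cos_mul_exp_nonneg {V ι : Type*} [Fintype V] [Fintype ι]
    (G : BondSystem V ι) {β : ℝ} (hβ : 0 ≤ β) (x y : V) :
    0 ≤ ∫ θ in Set.pi univ (fun _ : V => Icc (0 : ℝ) (2 * Real.pi)),
      Real.cos (θ x - θ y) * Real.exp (β * ∑ a, Real.cos (θ (G.tgt a) - θ (G.src a))) := by
  borelize Circle
  have hc : Continuous fun u : V → Circle => cosDiff x y u * G.weight β 1 u :=
    (continuous_cosDiff x y).mul (G.continuous_weight β 1)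
  have h := G.integral_cosDiff_mul_weight_one_nonneg hβ x y
  rw [integral_torusHaar_eq_smul_setIntegral_Icc _ hc.aestronglyMeasurable, smul_eq_mul] at h
  simp_rw [cosDiff_exp, BondSystem.weight_one_exp] at h
  exact (mul_nonneg_iff_of_pos_left (by positivity)).1 h

/-- **Griffiths' first inequality for the plane rotator on the discrete torus `(ℤ/Lℤ)^d`, angle
form**: for `J ≥ 0` and sites `x, y`,
`0 ≤ ∫_{[0,2π]^Λ} cos(θ_x − θ_y) exp (J ∑_{(z,i)} cos(θ_{z+e_i} − θ_z)) dθ`, the sum over the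
directed bonds `(z, i) : TorusSite d L × Fin d` (the vocabulary of
`FriedliVelenik2017_thm1025_planeRotator3` and of the Hubbard route `NodalWardXY`).
[cite: Ginibre1970, main theorem with the plane-rotator example] -/
theorem setIntegral_torus_cos_mul_exp_nonneg {d : ℕ} (L : ℕ) [NeZero L] {J : ℝ} (hJ : 0 ≤ J)
    (x y : TorusSite d L) :
    0 ≤ ∫ θ in Set.pi univ (fun _ : TorusSite d L => Icc (0 : ℝ) (2 * Real.pi)),
      Real.cos (θ x - θ y) *
        Real.exp (J * ∑ b : TorusSite d L × Fin d, Real.cos (θ (b.1 + Pi.single b.2 1) - θ b.1)) :=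
  (⟨Prod.fst, fun b => b.1 + Pi.single b.2 1⟩ :
      BondSystem (TorusSite d L) (TorusSite d L × Fin d)).setIntegral_cos_mul_exp_nonneg hJ x y

end Literature.Probability.LatticeModels
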